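import Summits.ValiantsHypothesis.ValiantsHypothesis.Theorems.BarrierLeverChowBenchmarkPairsDualisation

/-!
# Route BarrierLever — item 22038 `ChowBenchmarkPairs`, line `moore-peel`: segment-moment rows over a commutative
# ring, adjoining one point `x·𝟙_A`, and the `X`-degrees / top coefficients of the new rows (tools for the RIGID
# EXTENSION (PEELING) LEMMA, file `…ChowBenchmarkPairsPeel.lean`)

Helper file (`--supports stmt-ValiantsHypothesis-22038`; cell valiant-natproofs, rung V4, 𝒟-side benchmark of record;
seat val-np-p4 gen 21).  Closes NO item.

* `segE P S T = Σ_{g : T → S} ∏_{c∈T} P_{g(c),c} · ∏_{a∈S} |g⁻¹(a)|!` — the line file's `segEntry` verbatim, for a table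
  `P : π → κ → R` over any commutative ring (`map_segE`: ring homomorphisms act entrywise); `segE_singleton`,
  `segE_pair` (rows of size one and two as subset sums; the proofs of `ChowBenchmarkDual.segSum_singleton/_pair`
  verbatim in this generality).
* `coeff_det_of_natDegree_le` — if every entry of a square matrix over `R[X]` has degree `≤ d`, the coefficient of
  `X^{N d}` of the determinant is the determinant of the `X^d`-coefficients (Leibniz + `Polynomial.coeff_prod_of_natDegree_le`).
* `adjoin P q` (the table with the point `q` adjoined as `none : Option (Fin n)`), `segE_adjoin_map` (old rows keep
  their entries), `indPt A x = x·𝟙_A`, `segE_new_single` / `segE_new_pair` (the rows `{new}`, `{a,new}`).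
* Over `R[X]` with the new point `X·𝟙_A` (`symbTable`): `natDegree_new_single_le`, `natDegree_new_pair_le` (degree
  `≤ |A|`), `coeff_new_single` (`[T = A]·|A|!`), `coeff_new_pair` (`[A ⊆ T]·|T∖A|!·|A|!·P_a^{T∖A}`),
  `segE_symbTable_old` (old rows are constants).

WHAT THIS IS NOT: no stub of the line is closed; nothing on crux stmt-ValiantsHypothesis-14610 or on `VP` versus `VNP`.
-/

set_option linter.dupNamespace false

namespace Summit.ValiantsHypothesis.ValiantsHypothesis.Theorems.BarrierLever.ChowBenchmarkPeel

open Finset Polynomial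

variable {κ : Type*} [DecidableEq κ]

/-! ## 1. The segment entry over a commutative ring -/

/-- The segment-moment entry `Σ_{g : T → S} ∏_{c∈T} P_{g(c),c} · ∏_{a∈S} |g⁻¹(a)|!` of a point table
`P : π → κ → R` at row `S ⊆ π` and column `T ⊆ κ` (the line file's `segEntry`, over any commutative ring and any
coordinate type). -/
def segE {R : Type*} [CommRing R] {π : Type*} [DecidableEq π] (P : π → κ → R) (S : Finset π) (T : Finset κ) :
    R :=
  ∑ g : (↥T → ↥S), (∏ c : ↥T, P (g c) c) *
    ∏ a : ↥S, ((Finset.univ.filter fun c : ↥T => g c = a).card.factorial : R)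

/-- Ring homomorphisms act on segment entries entrywise on the table. -/
theorem map_segE {R R' : Type*} [CommRing R] [CommRing R'] (f : R →+* R') {π : Type*} [DecidableEq π]
    (P : π → κ → R)
    (S : Finset π) (T : Finset κ) :
    f (segE P S T) = segE (fun a c => f (P a c)) S T := by
  unfold segE
  rw [map_sum]
  refine Finset.sum_congr rfl fun g _ => ?_
  rw [map_mul, map_prod, map_prod]
  congr 1
  exact Finset.prod_congr rfl fun a _ => by rw [map_natCast]

/-! ## 2. The leading coefficient of a determinant with polynomial rows -/

/-- If every entry of a square matrix over `R[X]` has degree `≤ d`, the coefficient of `X^{N d}` (`N` = size) of its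
determinant is the determinant of the matrix of `X^d`-coefficients. -/
theorem coeff_det_of_natDegree_le {R : Type*} [CommRing R] {ι : Type*} [Fintype ι] [DecidableEq ι]
    (M : Matrix ι ι R[X]) (d : ℕ) (hM : ∀ i j, (M i j).natDegree ≤ d) :
    (M.det).coeff (Fintype.card ι * d) = (Matrix.of fun i j => (M i j).coeff d).det := by
  rw [Matrix.det_apply', Matrix.det_apply', Polynomial.finsetSum_coeff]
  refine Finset.sum_congr rfl fun σ _ => ?_
  have hsign : ((Equiv.Perm.sign σ : ℤ) : R[X]) = Polynomial.C ((Equiv.Perm.sign σ : ℤ) : R) := by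
    simp
  rw [hsign, Polynomial.coeff_C_mul, ← Finset.card_univ, Polynomial.coeff_prod_of_natDegree_le]
  · rfl
  · intro i _
    exact hM _ _


/-! ## 3. Rows of size one and two as subset sums -/

section Rows

variable {R : Type*} [CommRing R] {π : Type*} [DecidableEq π]

/-- Row `{a}`: `segE P {a} T = |T|! · ∏_{c∈T} P a c` (the only map is the constant one). -/
theorem segE_singleton (P : π → κ → R) (a : π) (T : Finset κ) :
    segE P {a} T = (T.card.factorial : R) * ∏ c ∈ T, P a c := by
  classical
  unfold segE
  haveI hU : Unique ↥({a} : Finset (π)) :=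
    ⟨⟨⟨a, Finset.mem_singleton_self a⟩⟩, fun x => Subtype.ext (Finset.mem_singleton.mp x.2)⟩
  rw [Fintype.sum_unique]
  set g₀ : ↥T → ↥({a} : Finset (π)) := default with hg₀
  have hg : ∀ c : ↥T, ((g₀ c : ↥({a} : Finset (π))) : π) = a := fun c =>
    Finset.mem_singleton.mp (g₀ c).2
  rw [Fintype.prod_unique (fun a' : ↥({a} : Finset (π)) =>
    ((Finset.univ.filter fun c : ↥T => g₀ c = a').card.factorial : R))]
  have hfilter : (Finset.univ.filter fun c : ↥T => g₀ c = default) = Finset.univ :=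
    Finset.filter_true_of_mem fun c _ => Unique.eq_default _
  rw [hfilter, Finset.card_univ, Fintype.card_coe, mul_comm]
  congr 1
  rw [← Finset.prod_coe_sort T (fun c => P a c)]
  exact Finset.prod_congr rfl fun c _ => by rw [hg c]

/-- Row `{a, b}` (`a ≠ b`): `segE P {a,b} T = Σ_{d ⊆ T} |d|!·|T∖d|!·(∏_{c∈d} P a c)(∏_{c∈T∖d} P b c)`
(a map `g : T → {a,b}` is the same as the subset `d = g⁻¹(a) ⊆ T`). -/
theorem segE_pair (P : π → κ → R) (a b : π) (hab : a ≠ b) (T : Finset κ) :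
    segE P {a, b} T =
      ∑ d ∈ T.powerset, (d.card.factorial : R) * ((T \ d).card.factorial : R) *
        ((∏ c ∈ d, P a c) * ∏ c ∈ T \ d, P b c) := by
  classical
  unfold segE
  have ha : a ∈ ({a, b} : Finset (π)) := by simp
  have hb : b ∈ ({a, b} : Finset (π)) := by simp
  let dOf : (↥T → ↥({a, b} : Finset (π))) → Finset κ := fun g =>
    (Finset.univ.filter fun c : ↥T => ((g c : ↥({a, b} : Finset (π))) : π) = a).map
      (Function.Embedding.subtype _)
  let gOf : Finset κ → (↥T → ↥({a, b} : Finset (π))) := fun d c =>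
    if (c : κ) ∈ d then ⟨a, ha⟩ else ⟨b, hb⟩
  have mem_dOf : ∀ g (c : κ), c ∈ dOf g ↔ ∃ hc : c ∈ T, ((g ⟨c, hc⟩ : π)) = a := by
    intro g c
    simp only [dOf, Finset.mem_map, Finset.mem_filter, Finset.mem_univ, true_and,
      Function.Embedding.coe_subtype, Subtype.exists, exists_and_right, exists_eq_right]
  have dOf_sub : ∀ g, dOf g ⊆ T := fun g c hc => ((mem_dOf g c).mp hc).1
  have gval : ∀ (g : ↥T → ↥({a, b} : Finset (π))) (c : ↥T),
      ((g c : π) = a ∧ (c : κ) ∈ dOf g) ∨ ((g c : π) = b ∧ (c : κ) ∉ dOf g) := by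
    intro g c
    rcases Finset.mem_insert.mp (g c).2 with hga | hgb
    · exact Or.inl ⟨hga, (mem_dOf g c).mpr ⟨c.2, by simpa using hga⟩⟩
    · rw [Finset.mem_singleton] at hgb
      refine Or.inr ⟨hgb, fun hc => ?_⟩
      obtain ⟨hc', e⟩ := (mem_dOf g c).mp hc
      exact hab (by rw [← hgb]; simpa using e.symm)
  refine Finset.sum_bij' (fun g _ => dOf g) (fun d _ => gOf d) ?_ ?_ ?_ ?_ ?_
  · exact fun g _ => Finset.mem_powerset.mpr (dOf_sub g)
  · exact fun d _ => Finset.mem_univ _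
  · intro g _
    funext c
    rcases gval g c with ⟨hga, hcd⟩ | ⟨hgb, hcd⟩
    · exact Subtype.ext (by simp only [gOf, if_pos hcd]; exact hga.symm)
    · exact Subtype.ext (by simp only [gOf, if_neg hcd]; exact hgb.symm)
  · intro d hd
    have hdT : d ⊆ T := Finset.mem_powerset.mp hd
    ext c
    rw [mem_dOf]
    constructor
    · rintro ⟨hc, e⟩
      by_contra hcd
      simp only [gOf, if_neg hcd] at e
      exact hab e.symm
    · intro hcd
      exact ⟨hdT hcd, by simp only [gOf, if_pos hcd]⟩
  · intro g _
    set d := dOf g with hd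
    have hdT : d ⊆ T := dOf_sub g
    have hprod : (∏ c : ↥T, P (g c) c) = (∏ c ∈ d, P a c) * ∏ c ∈ T \ d, P b c := by
      have e1 : (∏ c : ↥T, P (g c) c) = ∏ c : ↥T, (if (c : κ) ∈ d then P a c else P b c) := by
        refine Finset.prod_congr rfl fun c _ => ?_
        rcases gval g c with ⟨hga, hcd⟩ | ⟨hgb, hcd⟩
        · rw [if_pos hcd, hga]
        · rw [if_neg hcd, hgb]
      rw [e1, Finset.prod_coe_sort T (fun c => if c ∈ d then P a c else P b c), Finset.prod_ite,
        Finset.filter_mem_eq_inter, Finset.inter_eq_right.mpr hdT, Finset.filter_not,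
        Finset.filter_mem_eq_inter, Finset.inter_eq_right.mpr hdT]
    have hfa : (Finset.univ.filter fun c : ↥T => ((g c : ↥({a, b} : Finset (π))) : π) = a).card
        = d.card := by
      rw [hd]
      simp only [dOf, Finset.card_map]
    have hfb : (Finset.univ.filter fun c : ↥T => ((g c : ↥({a, b} : Finset (π))) : π) = b).card
        = (T \ d).card := by
      have e1 : (Finset.univ.filter fun c : ↥T => ((g c : ↥({a, b} : Finset (π))) : π) = b) =
          Finset.univ.filter fun c : ↥T => ¬ (((g c : ↥({a, b} : Finset (π))) : π) = a) := by
        ext c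
        simp only [Finset.mem_filter, Finset.mem_univ, true_and]
        rcases gval g c with ⟨hga, _⟩ | ⟨hgb, _⟩
        · rw [hga]
          exact ⟨fun e => absurd e hab, fun ne => absurd rfl ne⟩
        · rw [hgb]
          exact ⟨fun _ => fun e => hab e.symm, fun _ => rfl⟩
      rw [e1, Finset.filter_not, Finset.card_sdiff_of_subset (Finset.filter_subset _ _), hfa,
        Finset.card_univ, Fintype.card_coe, Finset.card_sdiff_of_subset hdT]
    have hw : (∏ a' : ↥({a, b} : Finset (π)),
        ((Finset.univ.filter fun c : ↥T => g c = a').card.factorial : R)) =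
        (d.card.factorial : R) * ((T \ d).card.factorial : R) := by
      have e : ∀ a' : ↥({a, b} : Finset (π)), (Finset.univ.filter fun c : ↥T => g c = a') =
          Finset.univ.filter fun c : ↥T => ((g c : ↥({a, b} : Finset (π))) : π) = (a' : π) :=
        fun a' => by
          ext c
          simp only [Finset.mem_filter, Finset.mem_univ, true_and]
          exact ⟨fun e => by rw [e], fun e => Subtype.ext e⟩
      simp_rw [e]
      rw [Finset.prod_coe_sort ({a, b} : Finset (π)) (fun x : π =>
        ((Finset.univ.filter fun c : ↥T => ((g c : ↥({a, b} : Finset (π))) : π) = x).card.factorial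
          : R)), Finset.prod_pair hab, hfa, hfb]
    rw [hprod, hw]
    ring

end Rows


/-! ## 4. Adjoining one point -/

section Adjoin

variable {R : Type*} [CommRing R] {n : ℕ}

/-- Rows of the `n`-point configuration: the subsets of `Fin n` of size `≤ 2`. -/
abbrev Row (n : ℕ) := {S : Finset (Fin n) // S.card ≤ 2}

/-- The table with one point `q` adjoined (points indexed by `Option (Fin n)`; the new point is `none`). -/
def adjoin (P : Fin n → κ → R) (q : κ → R) : Option (Fin n) → κ → R := fun o => o.elim q P

omit [DecidableEq κ] [CommRing R] in
/-- The adjoined point. -/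
@[simp] theorem adjoin_none (P : Fin n → κ → R) (q : κ → R) : adjoin P q none = q := rfl

omit [DecidableEq κ] [CommRing R] in
/-- The old points. -/
@[simp] theorem adjoin_some (P : Fin n → κ → R) (q : κ → R) (a : Fin n) : adjoin P q (some a) = P a := rfl

/-- The old rows, re-read in the enlarged point set. -/
noncomputable def liftEquiv (S : Finset (Fin n)) : ↥S ≃ ↥(S.map (Function.Embedding.some)) where
  toFun a := ⟨some a.1, Finset.mem_map_of_mem _ a.2⟩
  invFun b := ⟨(Finset.mem_map.mp b.2).choose, (Finset.mem_map.mp b.2).choose_spec.1⟩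
  left_inv a := by
    apply Subtype.ext
    have h := (Finset.mem_map.mp (Finset.mem_map_of_mem Function.Embedding.some a.2)).choose_spec.2
    exact Option.some_injective _ h
  right_inv b := by
    apply Subtype.ext
    exact (Finset.mem_map.mp b.2).choose_spec.2

/-- `liftEquiv` is `some` on values. -/
theorem liftEquiv_val (S : Finset (Fin n)) (a : ↥S) : ((liftEquiv S a : ↥(S.map Function.Embedding.some)) :
    Option (Fin n)) = some (a : Fin n) := rfl

/-- An old row has the same entries in the enlarged configuration (no map `T → S.map some` hits the new point). -/
theorem segE_adjoin_map (P : Fin n → κ → R) (q : κ → R) (S : Finset (Fin n)) (T : Finset κ) :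
    segE (adjoin P q) (S.map Function.Embedding.some) T = segE P S T := by
  classical
  unfold segE
  set e := liftEquiv S with he
  refine Fintype.sum_equiv (Equiv.arrowCongr (Equiv.refl ↥T) e.symm) _ _ fun g => ?_
  have hga : ∀ c : ↥T, (Equiv.arrowCongr (Equiv.refl ↥T) e.symm g) c = e.symm (g c) := by
    intro c
    simp only [Equiv.arrowCongr_apply, Function.comp_apply, Equiv.refl_symm, Equiv.refl_apply]
  have hg : ∀ c : ↥T, ((g c : ↥(S.map Function.Embedding.some)) : Option (Fin n)) =
      some ((e.symm (g c) : ↥S) : Fin n) := by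
    intro c
    conv_lhs => rw [← e.apply_symm_apply (g c)]
    rfl
  congr 1
  · refine Finset.prod_congr rfl fun c _ => ?_
    rw [hga c, hg c]
    rfl
  · refine Fintype.prod_equiv e.symm _ _ fun a => ?_
    have hf : (Finset.univ.filter fun c : ↥T => g c = a) =
        Finset.univ.filter fun c : ↥T => (Equiv.arrowCongr (Equiv.refl ↥T) e.symm g) c = e.symm a := by
      ext c
      simp only [Finset.mem_filter, Finset.mem_univ, true_and]
      rw [hga c]
      exact e.symm.injective.eq_iff.symm
    rw [hf]

/-- The indicator point `x·𝟙_A`. -/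
def indPt (A : Finset κ) (x : R) : κ → R := fun c => if c ∈ A then x else 0

/-- A monomial of the indicator point: `∏_{c∈T} (x·𝟙_A)_c = [T ⊆ A] x^{|T|}`. -/
theorem prod_indPt (A : Finset κ) (x : R) (T : Finset κ) :
    (∏ c ∈ T, indPt A x c) = if T ⊆ A then x ^ T.card else 0 := by
  unfold indPt
  rw [Finset.prod_ite, Finset.prod_const, Finset.prod_const]
  by_cases hT : T ⊆ A
  · rw [if_pos hT]
    have h1 : T.filter (fun c => c ∈ A) = T := Finset.filter_true_of_mem fun c hc => hT hc
    have h2 : T.filter (fun c => ¬ c ∈ A) = ∅ := by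
      rw [Finset.filter_eq_empty_iff]; exact fun c hc => not_not.mpr (hT hc)
    rw [h1, h2, Finset.card_empty, pow_zero, mul_one]
  · rw [if_neg hT]
    obtain ⟨c, hcT, hcA⟩ := Finset.not_subset.mp hT
    have : 0 < (T.filter (fun c => ¬ c ∈ A)).card :=
      Finset.card_pos.mpr ⟨c, Finset.mem_filter.mpr ⟨hcT, hcA⟩⟩
    rw [zero_pow (Nat.pos_iff_ne_zero.mp this), mul_zero]

/-- Row `{new}` of the enlarged configuration: `|T|!·[T ⊆ A]·x^{|T|}`. -/
theorem segE_new_single (P : Fin n → κ → R) (A : Finset κ) (x : R) (T : Finset κ) :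
    segE (adjoin P (indPt A x)) {none} T = if T ⊆ A then (T.card.factorial : R) * x ^ T.card else 0 := by
  rw [segE_singleton, adjoin_none, prod_indPt]
  split_ifs <;> simp

/-- Row `{a, new}` of the enlarged configuration:
`Σ_{d ⊆ T, T∖d ⊆ A} |d|!·|T∖d|!·P_a^d · x^{|T∖d|}`. -/
theorem segE_new_pair (P : Fin n → κ → R) (A : Finset κ) (x : R) (a : Fin n) (T : Finset κ) :
    segE (adjoin P (indPt A x)) {some a, none} T =
      ∑ d ∈ T.powerset, if T \ d ⊆ A then
        (d.card.factorial : R) * ((T \ d).card.factorial : R) * (∏ c ∈ d, P a c) * x ^ (T \ d).card else 0 := by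
  rw [segE_pair _ _ _ (Option.some_ne_none a)]
  refine Finset.sum_congr rfl fun d _ => ?_
  rw [adjoin_some, adjoin_none, prod_indPt]
  split_ifs <;> ring

end Adjoin


/-! ## 5. The new rows as polynomials in the scalar of the new point: degrees and top coefficients -/

section Degrees

variable {R : Type*} [CommRing R] {n : ℕ}

/-- The old table read in `R[X]` (constant polynomials). -/
noncomputable def constTable (P : Fin n → κ → R) : Fin n → κ → R[X] := fun a c => C (P a c)

/-- The symbolic enlarged table: old points constant, new point `X·𝟙_A`. -/
noncomputable def symbTable (P : Fin n → κ → R) (A : Finset κ) : Option (Fin n) → κ → R[X] :=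
  adjoin (constTable P) (indPt A X)

/-- The row `{new}` has `X`-degree `≤ |A|`. -/
theorem natDegree_new_single_le (P : Fin n → κ → R) (A T : Finset κ) :
    (segE (symbTable P A) {none} T).natDegree ≤ A.card := by
  rw [symbTable, segE_new_single]
  split_ifs with hT
  · rw [← map_natCast C]
    exact (natDegree_C_mul_X_pow_le _ _).trans (Finset.card_le_card hT)
  · simp

/-- The `X^{|A|}`-coefficient of the row `{new}` is `[T = A]·|A|!`. -/
theorem coeff_new_single (P : Fin n → κ → R) (A T : Finset κ) :
    (segE (symbTable P A) {none} T).coeff A.card = if T = A then (A.card.factorial : R) else 0 := by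
  rw [symbTable, segE_new_single]
  by_cases hT : T ⊆ A
  · rw [if_pos hT, ← map_natCast C, coeff_C_mul_X_pow]
    by_cases hTA : T = A
    · subst hTA; simp
    · have hlt : T.card < A.card := Finset.card_lt_card (Finset.ssubset_iff_subset_ne.mpr ⟨hT, hTA⟩)
      rw [if_neg (Nat.ne_of_gt hlt), if_neg hTA]
  · have hTA : T ≠ A := fun e => hT (e ▸ Finset.Subset.refl _)
    rw [if_neg hT, if_neg hTA, coeff_zero]

/-- The row `{a, new}` has `X`-degree `≤ |A|`. -/
theorem natDegree_new_pair_le (P : Fin n → κ → R) (A : Finset κ) (a : Fin n) (T : Finset κ) :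
    (segE (symbTable P A) {some a, none} T).natDegree ≤ A.card := by
  rw [symbTable, segE_new_pair]
  refine natDegree_sum_le_of_forall_le _ _ fun d _ => ?_
  split_ifs with hd
  · simp only [constTable]
    rw [← map_natCast C, ← map_natCast C, ← map_prod C, ← map_mul, ← map_mul]
    exact (natDegree_C_mul_X_pow_le _ _).trans (Finset.card_le_card hd)
  · simp

/-- The `X^{|A|}`-coefficient of the row `{a, new}` is `[A ⊆ T]·|T∖A|!·|A|!·P_a^{T∖A}`. -/
theorem coeff_new_pair (P : Fin n → κ → R) (A : Finset κ) (a : Fin n) (T : Finset κ) :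
    (segE (symbTable P A) {some a, none} T).coeff A.card =
      if A ⊆ T then ((T \ A).card.factorial : R) * (A.card.factorial : R) * ∏ c ∈ T \ A, P a c else 0 := by
  rw [symbTable, segE_new_pair, finsetSum_coeff]
  have hterm : ∀ d ∈ T.powerset,
      (if T \ d ⊆ A then ((d.card.factorial : R[X]) * ((T \ d).card.factorial : R[X]) *
          (∏ c ∈ d, constTable P a c) * X ^ (T \ d).card) else 0).coeff A.card =
        if T \ d = A then (d.card.factorial : R) * (A.card.factorial : R) * ∏ c ∈ d, P a c else 0 := by
    intro d _
    by_cases h1 : T \ d ⊆ A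
    · rw [if_pos h1]
      simp only [constTable]
      rw [← map_natCast C, ← map_natCast C, ← map_prod C, ← map_mul, ← map_mul, coeff_C_mul_X_pow]
      by_cases h2 : T \ d = A
      · rw [if_pos (by rw [h2]), if_pos h2, h2]
      · have hlt : (T \ d).card < A.card := Finset.card_lt_card (Finset.ssubset_iff_subset_ne.mpr ⟨h1, h2⟩)
        rw [if_neg (Nat.ne_of_gt hlt), if_neg h2]
    · have h2 : T \ d ≠ A := fun e => h1 (e ▸ Finset.Subset.refl _)
      rw [if_neg h1, if_neg h2, coeff_zero]
  rw [Finset.sum_congr rfl hterm]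
  by_cases hA : A ⊆ T
  · rw [if_pos hA, Finset.sum_eq_single (T \ A)]
    · rw [if_pos (Finset.sdiff_sdiff_eq_self hA)]
    · intro d hd hne
      rw [if_neg]
      intro e
      apply hne
      rw [← e, Finset.sdiff_sdiff_eq_self (Finset.mem_powerset.mp hd)]
    · intro h
      exact absurd (Finset.mem_powerset.mpr Finset.sdiff_subset) h
  · rw [if_neg hA]
    refine Finset.sum_eq_zero fun d hd => ?_
    rw [if_neg]
    intro e
    exact hA (e ▸ Finset.sdiff_subset)

/-- Old rows of the symbolic table are constants. -/
theorem segE_symbTable_old (P : Fin n → κ → R) (A : Finset κ) (S : Finset (Fin n)) (T : Finset κ) :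
    segE (symbTable P A) (S.map Function.Embedding.some) T = C (segE P S T) := by
  rw [symbTable, segE_adjoin_map]
  exact (map_segE C P S T).symm

end Degrees


end Summit.ValiantsHypothesis.ValiantsHypothesis.Theorems.BarrierLever.ChowBenchmarkPeel
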